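/-
Copyright (c) 2026 the pub-hodgecm-mathlib formalisation cell (harness21).  Prover seat hodgecm-mathlib-K2E3-p12 (g3), Track B «K2-LIT» ∕ h413
(`stmt-HodgeConjecture-24833`), line `K2_E3_EllipticInputs`, unit U12-d, row 12: the first ANALYTIC leaf of the Lie-algebra core (L-B_GL) at `N = 2` —
`|Q|^{-1∕2}` IS INTEGRABLE OVER BOXES for a diagonal non-degenerate quadratic form `Q` in `≥ 3` variables over a non-archimedean local field.  2026-09-04.
-/
import Literature.NumberTheory.Weil1965.LocalQuadraticFibreDensityMass     -- ★ `exists_continuous_fibreDensity` (Weil 1965 Prop. 6), `exists_sum_sq_mem_primePowBall_of_ne_zero`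
import Literature.NumberTheory.Automorphic.LocalFieldHaarBalls              -- ★ `LocalFieldHaar.mem_shell_iff`, `measureReal_shell`, `disjoint_shell`, `measurableSet_shell`
import HarnessLib

/-!
# K2_E3 road (h413), unit U12-d — `∫_{box} |Q(x)|_F^{-1∕2} dx < ∞` for a diagonal non-degenerate form in `≥ 3` variables

Cell `pub/hodgecm-mathlib` (D-0151), Track B (21-frontier RULING «PUSH BOTH» 2026-09-03, director req624), seat K2E3-p12 (g3), lineage of row 12; dealer
K2E3-plan (g2) deal (D12) 2026-09-04T01:19:47Z, self-deal (ii) GO.  `--supports stmt-HodgeConjecture-24833 --as helper`; THEOREMS ONLY (no definition ∕ instance ∕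
notation ∕ named fact ∕ `sorry`); never imports `Cruxes/…/Lines`.

WHY.  The Lie-algebra core (L-B_GL) of row 12 (`subsig_K2E3GLnNilpotentFourierRegular`: Harish-Chandra's Thm. 4.4 for `J(𝒩)` on `𝔤𝔩_N(F)`) asserts in particular
that the Fourier transforms `μ̂_𝒪` of the nilpotent orbital integrals are LOCALLY INTEGRABLE functions with `|η|^{1∕2} μ̂_𝒪` locally bounded
[HarishChandra1999, Thm. 4.4 (1)–(3)]; on `𝔤𝔩₂(F)` this comes down (regular nilpotent orbit; also the van Dijk ∕ Weyl-integration road for principal series)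
to the local integrability of `Y ↦ |disc χ_Y|_F^{-1∕2} = |η_{𝔤𝔩₂}(Y)|^{-1∕2}`, and `disc χ_Y = (Y₀₀ − Y₁₁)² + (Y₀₁ + Y₁₀)² − (Y₀₁ − Y₁₀)²` is a DIAGONAL NON-DEGENERATE
TERNARY FORM in linear coordinates.  This file proves the form-level statement, for every diagonal `Q(x) = Σᵢ cᵢ xᵢ²` with all `cᵢ ≠ 0` in `r ≥ 3` variables
(Igusa: the local zeta function `∫ |Q|^s` converges for `Re s > −1` when `r ≥ 3`; here `s = −1∕2`):

* **`lintegral_piPrimePowBall_sqrt_normAbs_inv_lt_top`** — `∫⁻_{(𝔭^{n₀})^ι} (√|Q(x)|_F)⁻¹ dμ^⊗ι < ∞` (`F` with `2 ≠ 0` and a continuous non-trivial `ψ`, `μ` any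
  additive Haar measure on `F`; the integrand is `0` on the null cone `Q = 0`, as `(√0)⁻¹ = 0` in `ℝ≥0`).
  PROOF (fibre integration): by ★ `exists_continuous_fibreDensity` [Weil1965, Chap. III n° 36 Prop. 6] the image of `1_{box} dx` under `Q` has a CONTINUOUS
  BOUNDED density `D` against `db` on `F` (`∫ D·g db = ∫ 1_{box}(x) g(Q x) dx` for `g ∈ 𝒮(F)`); testing against the Schwartz–Bruhat truncations
  `g_k = Σ_{i<k} q^{(m+i)∕2} 1_{𝔭^{m+i} ∖ 𝔭^{m+i+1}}` of `(√|b|)⁻¹` on `𝔭^m ⊇ Q(box)` gives `Σ_{i<k} q^{(m+i)∕2} μ^⊗ι(box ∩ Q⁻¹(shell_{m+i})) ≤ ‖D‖_∞ ·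
  Σ_i q^{(m+i)∕2} μ(shell_{m+i})`, a convergent geometric series (`μ(shell_j) = q^{-j}(1 − q⁻¹) μ(𝒪)`, ratio `q^{-1∕2}`); and the left side exhausts the integral
  (shell decomposition of `𝔭^m ∖ {0}`, monotone convergence as a `tsum`).
[HarishChandra1999AdmissibleDistributions, Thm. 4.4 p. 11, Thm. 6.1 ∕ Cor. 6.2 p. 45] [Weil1965, Chap. III n° 36 Prop. 6 p. 54] [Igusa1978, Ch. II §7 Thm. 1].
HONEST LABEL: HC_CM is proved only modulo the 7 printed citations (2 remaining named inputs: hLiu418 = stmt-HodgeConjecture-24832, h413 =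
stmt-HodgeConjecture-24833) until rung 0 closes; count-neutral helper; the transport to `𝔤𝔩₂(F)` is the sequel file `K2E3GL2DiscrInvSqrtLocallyIntegrable`.

## References
* [HarishChandra1999AdmissibleDistributions] Harish-Chandra (DeBacker–Sally), *Admissible Invariant Distributions on Reductive p-adic Groups* (1999), Thm. 4.4, Thm. 6.1, Cor. 6.2.
* [Weil1965] A. Weil, *Sur la formule de Siegel dans la théorie des groupes classiques*, Acta Math. 113 (1965), Chap. III n° 34–36, Prop. 6.
* [Igusa1978] J.-I. Igusa, *Lectures on Forms of Higher Degree*, Tata Institute (1978), Ch. II §7 (local zeta functions of quadratic forms).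
-/

set_option autoImplicit false
set_option linter.dupNamespace false   -- `Summit.HodgeConjecture.HodgeConjecture.…` (D-0017 nested layout; lakefile exemption for Summits)

noncomputable section

open MeasureTheory Filter Topology Set
open scoped NNReal ENNReal
open Literature.NumberTheory.Automorphic Literature.NumberTheory.Automorphic.LocalFieldHaar Literature.NumberTheory.Weil1965
open Literature.NumberTheory.GaloisRepresentations Literature.NumberTheory.GaloisRepresentations.IsNonarchimedeanLocalField

namespace Summit.HodgeConjecture.HodgeConjecture.Cruxes.H413.K2E3DiagonalFormInvSqrtIntegrable

variable {F : Type*} [Field F] [ValuativeRel F] [TopologicalSpace F] [IsNonarchimedeanLocalField F]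

/-! ## §1  Shells: Schwartz–Bruhat indicators, the value of `(√|b|)⁻¹`, exhaustion of `𝔭^m ∖ {0}` -/

/-- The indicator of a shell `𝔭^j ∖ 𝔭^{j+1}` is Schwartz–Bruhat (`1_{S_j} = 1_{𝔭^j} − 1_{𝔭^{j+1}}`, ★ `indicator_primePowBall_mem_schwartzBruhat`). [cite: WeilBNT1967, Ch. VII §2, Def. 1] -/
theorem indicator_shell_mem_schwartzBruhat (j : ℤ) (z : ℂ) :
    (primePowBall F j \ primePowBall F (j + 1)).indicator (fun _ => z) ∈ SchwartzBruhat F := by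
  have e : (primePowBall F j \ primePowBall F (j + 1)).indicator (fun _ => z) =
      (primePowBall F j).indicator (fun _ => z) - (primePowBall F (j + 1)).indicator (fun _ => z) := by
    funext x
    simp only [Pi.sub_apply]
    by_cases h1 : x ∈ primePowBall F (j + 1)
    · have h0 : x ∈ primePowBall F j := primePowBall_antitone (by omega) h1
      have hxS : x ∉ primePowBall F j \ primePowBall F (j + 1) := fun h => h.2 h1
      rw [Set.indicator_of_notMem hxS, Set.indicator_of_mem h0, Set.indicator_of_mem h1, sub_self]
    · by_cases h0 : x ∈ primePowBall F j
      · rw [Set.indicator_of_mem (show x ∈ primePowBall F j \ primePowBall F (j + 1) from ⟨h0, h1⟩), Set.indicator_of_mem h0,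
          Set.indicator_of_notMem h1, sub_zero]
      · have hxS : x ∉ primePowBall F j \ primePowBall F (j + 1) := fun h => h0 h.1
        rw [Set.indicator_of_notMem hxS, Set.indicator_of_notMem h0, Set.indicator_of_notMem h1, sub_zero]
  rw [e]
  exact Submodule.sub_mem _ (indicator_primePowBall_mem_schwartzBruhat j z) (indicator_primePowBall_mem_schwartzBruhat (j + 1) z)

/-- On the shell `𝔭^j ∖ 𝔭^{j+1}` the weight `(√|b|_F)⁻¹` is the constant `(√(q^{-j}))⁻¹` (★ `mem_shell_iff`). [cite: WeilBNT1967, Ch. I §4] -/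
theorem sqrt_normAbs_inv_of_mem_shell {j : ℤ} {b : F} (hb : b ∈ primePowBall F j \ primePowBall F (j + 1)) :
    (NNReal.sqrt (normAbs F b))⁻¹ = (NNReal.sqrt ((residueFieldCard F : ℝ≥0)⁻¹ ^ j))⁻¹ := by
  rw [mem_shell_iff.1 hb]

/-- A non-zero element of `𝔭^m` lies in exactly one shell `𝔭^{m+i} ∖ 𝔭^{m+i+1}`, `i ∈ ℕ` (existence; uniqueness is ★ `disjoint_shell`):
`|b| = q^{-k}` with `k ≥ m`. [cite: WeilBNT1967, Ch. I §4] -/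
theorem exists_mem_shell_of_mem_primePowBall {m : ℤ} {b : F} (hb : b ∈ primePowBall F m) (hb0 : b ≠ 0) :
    ∃ i : ℕ, b ∈ primePowBall F (m + i) \ primePowBall F (m + i + 1) := by
  obtain ⟨k, hk⟩ := exists_normAbs_eq_inv_zpow hb0
  have hmk : m ≤ k := by
    have h := mem_primePowBall_iff.1 hb
    rw [hk] at h
    exact (zpow_le_zpow_iff_right_of_lt_one₀ inv_residueFieldCard_pos inv_residueFieldCard_lt_one).1 h
  refine ⟨(k - m).toNat, ?_⟩
  rw [mem_shell_iff, hk, Int.toNat_of_nonneg (sub_nonneg.2 hmk), add_sub_cancel]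

/-! ## §2  `∫⁻_{box} (√|Q|)⁻¹ < ∞` -/

section Box

variable {ι : Type*} [Fintype ι] [MeasurableSpace F] [BorelSpace F] (μ : Measure F) [μ.IsAddHaarMeasure]

set_option maxHeartbeats 1600000 in
/-- **`∫⁻_{(𝔭^{n₀})^ι} (√|Σᵢ cᵢ xᵢ²|_F)⁻¹ dμ^⊗ι < ∞`** for a DIAGONAL NON-DEGENERATE form in `r = card ι ≥ 3` variables over a non-archimedean local field `F` with
`2 ≠ 0` carrying a continuous non-trivial additive character `ψ` (any additive Haar `μ`).  Fibre integration against Weil's continuous bounded density of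
`Q_*(1_{box} dx)` (★ `exists_continuous_fibreDensity`), tested on the Schwartz–Bruhat truncations of `(√|b|)⁻¹` shell by shell; the bound is the geometric
series `‖D‖_∞ Σ_i (√(q^{-(m+i)}))⁻¹ q^{-(m+i)} (1 − q⁻¹) μ(𝒪)`.  The integrand vanishes on the null cone (`(√0)⁻¹ = 0`).
[cite: Weil1965, Chap. III n° 36 Prop. 6, p. 54] [cite: HarishChandra1999AdmissibleDistributions, Thm. 4.4 p. 11] [cite: Igusa1978, Ch. II §7 Thm. 1] -/
theorem lintegral_piPrimePowBall_sqrt_normAbs_inv_lt_top {ψ : AddChar F Circle} (hψ : ψ.IsContinuousNontrivial) (h2 : (2 : F) ≠ 0)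
    {c : ι → F} (hc : ∀ i, c i ≠ 0) (hr : 3 ≤ Fintype.card ι) (n₀ : ℤ) :
    ∫⁻ x in piPrimePowBall F ι n₀, (((NNReal.sqrt (normAbs F (∑ i, c i * x i ^ 2)))⁻¹ : ℝ≥0) : ℝ≥0∞) ∂(Measure.pi fun _ : ι => μ) < ∞ := by
  classical
  haveI : T2Space F := (isLocalField F).toT2Space
  haveI : SecondCountableTopology F := secondCountableTopology_localField F
  haveI : LocallyCompactSpace F := (isLocalField F).toLocallyCompactSpace
  haveI : SigmaFinite μ := by infer_instance
  -- notation
  set ν : Measure (ι → F) := Measure.pi fun _ : ι => μ with hν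
  set B : Set (ι → F) := piPrimePowBall F ι n₀ with hB
  set Q : (ι → F) → F := fun x => ∑ i, c i * x i ^ 2 with hQ
  set q0 : ℝ≥0 := (residueFieldCard F : ℝ≥0)⁻¹ with hq0
  have hq0pos : 0 < q0 := inv_residueFieldCard_pos
  have hq0lt : q0 < 1 := inv_residueFieldCard_lt_one
  have hBm : MeasurableSet B := measurableSet_piPrimePowBall n₀
  have hQc : Continuous Q := continuous_finsetSum _ fun i _ => continuous_const.mul ((continuous_apply i).pow 2)
  haveI hνH : ν.IsAddHaarMeasure := by rw [hν]; infer_instance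
  -- Weil's continuous bounded fibre density of `Q_*(1_B dx)`
  obtain ⟨d, hd⟩ := hψ.exists_hasConductorExp
  obtain ⟨v₂, hv₂⟩ := exists_normAbs_eq_inv_zpow h2
  have hΦ : (B.indicator fun _ => (1 : ℂ)) ∈ SchwartzBruhat (ι → F) := indicator_piPrimePowBall_mem_schwartzBruhat n₀ 1
  obtain ⟨D, -, ⟨M, hM⟩, hDg⟩ := exists_continuous_fibreDensity μ hd hv₂ hc hΦ hr
  have hM0 : 0 ≤ M := (norm_nonneg _).trans (hM 0)
  -- `Q(B) ⊆ 𝔭^m`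
  obtain ⟨m, hm⟩ := exists_sum_sq_mem_primePowBall_of_ne_zero c hΦ
  have hmB : ∀ x ∈ B, Q x ∈ primePowBall F m := fun x hx => hm x (by rw [Set.indicator_of_mem hx]; exact one_ne_zero)
  -- shells, pieces, weights
  set S : ℕ → Set F := fun i => primePowBall F (m + i) \ primePowBall F (m + i + 1) with hS
  set A : ℕ → Set (ι → F) := fun i => B ∩ Q ⁻¹' (S i) with hA
  set w : ℕ → ℝ≥0 := fun i => (NNReal.sqrt (q0 ^ (m + (i : ℤ))))⁻¹ with hw
  have hSm : ∀ i, MeasurableSet (S i) := fun i => measurableSet_shell _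
  have hAm : ∀ i, MeasurableSet (A i) := fun i => hBm.inter (hQc.measurable (hSm i))
  have hAB : ∀ i, A i ⊆ B := fun i => Set.inter_subset_left
  have hνB : ν B < ∞ := measure_piPrimePowBall_lt_top ν n₀
  have hνA : ∀ i, ν (A i) < ∞ := fun i => (measure_mono (hAB i)).trans_lt hνB
  -- the geometric bound `I = Σ_i w_i μ(S_i)`
  set r : ℝ := Real.sqrt (q0 : ℝ) with hr
  have hr0 : 0 ≤ r := Real.sqrt_nonneg _
  have hr1 : r < 1 := by
    rw [hr, Real.sqrt_lt' one_pos, one_pow]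
    exact_mod_cast hq0lt
  set K : ℝ := Real.sqrt ((q0 : ℝ) ^ m) * (1 - (q0 : ℝ)) * μ.real (primePowBall F 0) with hK
  have hK0 : 0 ≤ K := by
    refine mul_nonneg (mul_nonneg (Real.sqrt_nonneg _) (sub_nonneg.2 ?_)) measureReal_nonneg
    exact_mod_cast hq0lt.le
  have hwS : ∀ i : ℕ, (w i : ℝ) * μ.real (S i) = K * r ^ i := by
    intro i
    have hq0R : (0 : ℝ) < q0 := by exact_mod_cast hq0pos
    have hpow : (q0 : ℝ) ^ (m + (i : ℤ)) = (q0 : ℝ) ^ m * (r ^ i) ^ 2 := by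
      rw [zpow_add₀ hq0R.ne', zpow_natCast, ← pow_mul, mul_comm i 2, pow_mul, hr, Real.sq_sqrt hq0R.le]
    have hsq : Real.sqrt ((q0 : ℝ) ^ (m + (i : ℤ))) = Real.sqrt ((q0 : ℝ) ^ m) * r ^ i := by
      rw [hpow, Real.sqrt_mul (zpow_nonneg hq0R.le m), Real.sqrt_sq (pow_nonneg hr0 i)]
    have hwR : (w i : ℝ) = (Real.sqrt ((q0 : ℝ) ^ (m + (i : ℤ))))⁻¹ := by
      simp only [hw, NNReal.coe_inv, Real.coe_sqrt, NNReal.coe_zpow]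
    have hqR : ((residueFieldCard F : ℝ)⁻¹) = (q0 : ℝ) := by rw [hq0, NNReal.coe_inv, NNReal.coe_natCast]
    have hshell : μ.real (S i) = (q0 : ℝ) ^ (m + (i : ℤ)) * (1 - (q0 : ℝ)) * μ.real (primePowBall F 0) := by
      rw [hS]
      simp only
      rw [measureReal_shell μ (m + i), hqR]
    rw [hwR, hshell, show (Real.sqrt ((q0 : ℝ) ^ (m + (i : ℤ))))⁻¹ * ((q0 : ℝ) ^ (m + (i : ℤ)) * (1 - (q0 : ℝ)) * μ.real (primePowBall F 0)) =
      ((q0 : ℝ) ^ (m + (i : ℤ)) / Real.sqrt ((q0 : ℝ) ^ (m + (i : ℤ)))) * (1 - (q0 : ℝ)) * μ.real (primePowBall F 0) by ring,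
      Real.div_sqrt, hsq, hK]
    ring
  have hsumm : Summable fun i : ℕ => (w i : ℝ) * μ.real (S i) := by
    rw [show (fun i : ℕ => (w i : ℝ) * μ.real (S i)) = fun i => K * r ^ i from funext hwS]
    exact (summable_geometric_of_lt_one hr0 hr1).mul_left K
  set I : ℝ := ∑' i : ℕ, (w i : ℝ) * μ.real (S i) with hI
  have hI0 : 0 ≤ I := tsum_nonneg fun i => mul_nonneg (NNReal.coe_nonneg _) measureReal_nonneg
  -- CLAIM 1: the partial sums are bounded by `M * I`
  have hpartial : ∀ k : ℕ, ∑ i ∈ Finset.range k, (w i : ℝ) * ν.real (A i) ≤ M * I := by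
    intro k
    -- the Schwartz–Bruhat truncation `g_k`
    set g : F → ℂ := fun b => ∑ i ∈ Finset.range k, ((w i : ℝ) : ℂ) * (S i).indicator (fun _ => (1 : ℂ)) b with hg
    have hgSB : g ∈ SchwartzBruhat F := by
      have : g = ∑ i ∈ Finset.range k, fun b => ((w i : ℝ) : ℂ) * (S i).indicator (fun _ => (1 : ℂ)) b := by
        funext b; simp only [hg, Finset.sum_apply]
      rw [this]
      refine Submodule.sum_mem _ fun i _ => ?_
      have h1 := Submodule.smul_mem (SchwartzBruhat F) (((w i : ℝ) : ℂ)) (indicator_shell_mem_schwartzBruhat (F := F) (m + i) 1)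
      have h2 : (fun b => ((w i : ℝ) : ℂ) * (S i).indicator (fun _ => (1 : ℂ)) b) =
          (((w i : ℝ) : ℂ)) • (primePowBall F (m + i) \ primePowBall F (m + i + 1)).indicator (fun _ => (1 : ℂ)) := by
        funext b; rfl
      rw [h2]; exact h1
    -- left side of Weil's identity = the partial sum (as a complex number)
    have hleft : ∫ x, B.indicator (fun _ => (1 : ℂ)) x * g (Q x) ∂ν = ((∑ i ∈ Finset.range k, (w i : ℝ) * ν.real (A i) : ℝ) : ℂ) := by
      have hpt : ∀ x, B.indicator (fun _ => (1 : ℂ)) x * g (Q x) =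
          ∑ i ∈ Finset.range k, ((w i : ℝ) : ℂ) * (A i).indicator (fun _ => (1 : ℂ)) x := by
        intro x
        simp only [hg, Finset.mul_sum]
        refine Finset.sum_congr rfl fun i _ => ?_
        by_cases hx : x ∈ B
        · by_cases hQx : Q x ∈ S i
          · rw [Set.indicator_of_mem hx, Set.indicator_of_mem hQx, Set.indicator_of_mem (show x ∈ A i from ⟨hx, hQx⟩)]; ring
          · rw [Set.indicator_of_notMem hQx, Set.indicator_of_notMem (show x ∉ A i from fun h => hQx h.2)]; ring
        · rw [Set.indicator_of_notMem hx, Set.indicator_of_notMem (show x ∉ A i from fun h => hx h.1)]; ring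
      simp_rw [hpt]
      rw [integral_finsetSum _ fun i _ => (Integrable.const_mul ((integrable_indicator_iff (hAm i)).2
        ((integrableOn_const_iff).2 (Or.inr (hνA i)))) _)]
      push_cast
      refine Finset.sum_congr rfl fun i _ => ?_
      rw [integral_const_mul, integral_indicator (hAm i), setIntegral_const, Complex.real_smul, mul_one]
    -- right side: `|∫ D g| ≤ M * I`
    have hgnorm : ∀ b, ‖g b‖ ≤ ∑ i ∈ Finset.range k, (w i : ℝ) * (S i).indicator (fun _ => (1 : ℝ)) b := by
      intro b
      refine (norm_sum_le _ _).trans (Finset.sum_le_sum fun i _ => ?_)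
      rw [norm_mul, Complex.norm_real, Real.norm_of_nonneg (NNReal.coe_nonneg _)]
      refine mul_le_mul_of_nonneg_left ?_ (NNReal.coe_nonneg _)
      by_cases hb : b ∈ S i
      · rw [Set.indicator_of_mem hb, Set.indicator_of_mem hb, norm_one]
      · rw [Set.indicator_of_notMem hb, Set.indicator_of_notMem hb, norm_zero]
    have hSfin : ∀ i, μ (S i) < ∞ := fun i => (measure_mono Set.sdiff_subset).trans_lt (measure_primePowBall_lt_top μ (m + i))
    have hmaj_int : Integrable (fun b => ∑ i ∈ Finset.range k, (w i : ℝ) * (S i).indicator (fun _ => (1 : ℝ)) b) μ :=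
      integrable_finsetSum _ fun i _ => ((integrable_indicator_iff (hSm i)).2 ((integrableOn_const_iff).2 (Or.inr (hSfin i)))).const_mul _
    have hright : ‖∫ b, D b * g b ∂μ‖ ≤ M * ∑ i ∈ Finset.range k, (w i : ℝ) * μ.real (S i) := by
      calc ‖∫ b, D b * g b ∂μ‖ ≤ ∫ b, M * ∑ i ∈ Finset.range k, (w i : ℝ) * (S i).indicator (fun _ => (1 : ℝ)) b ∂μ := by
            refine norm_integral_le_of_norm_le (hmaj_int.const_mul M) (Eventually.of_forall fun b => ?_)
            rw [norm_mul]
            exact mul_le_mul (hM b) (hgnorm b) (norm_nonneg _) hM0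
        _ = M * ∑ i ∈ Finset.range k, (w i : ℝ) * μ.real (S i) := by
            rw [integral_const_mul, integral_finsetSum _ fun i _ =>
              ((integrable_indicator_iff (hSm i)).2 ((integrableOn_const_iff).2 (Or.inr (hSfin i)))).const_mul _]
            congr 1
            refine Finset.sum_congr rfl fun i _ => ?_
            rw [integral_const_mul, integral_indicator (hSm i), setIntegral_const, smul_eq_mul, mul_one]
    have hle : ∑ i ∈ Finset.range k, (w i : ℝ) * μ.real (S i) ≤ I :=
      hsumm.sum_le_tsum _ fun i _ => mul_nonneg (NNReal.coe_nonneg _) measureReal_nonneg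
    -- assemble
    have hid := hDg g hgSB
    rw [hleft] at hid
    calc ∑ i ∈ Finset.range k, (w i : ℝ) * ν.real (A i)
        ≤ ‖((∑ i ∈ Finset.range k, (w i : ℝ) * ν.real (A i) : ℝ) : ℂ)‖ := by rw [Complex.norm_real]; exact le_abs_self _
      _ = ‖∫ b, D b * g b ∂μ‖ := by rw [hid]
      _ ≤ M * I := hright.trans (mul_le_mul_of_nonneg_left hle hM0)
  -- CLAIM 2: the integral is the series `Σ_i w_i ν(A_i)`
  have hpoint : ∀ x ∈ B, (((NNReal.sqrt (normAbs F (Q x)))⁻¹ : ℝ≥0) : ℝ≥0∞) = ∑' i : ℕ, (A i).indicator (fun _ => (w i : ℝ≥0∞)) x := by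
    intro x hx
    by_cases hQ0 : Q x = 0
    · rw [hQ0, map_zero, NNReal.sqrt_zero, inv_zero, ENNReal.coe_zero]
      symm
      refine ENNReal.tsum_eq_zero.2 fun i => Set.indicator_of_notMem (fun h => ?_) _
      have hQS : Q x ∈ S i := h.2
      exact ne_zero_of_mem_shell hQS hQ0
    · obtain ⟨i₀, hi₀⟩ := exists_mem_shell_of_mem_primePowBall (hmB x hx) hQ0
      have hxA : x ∈ A i₀ := ⟨hx, hi₀⟩
      rw [tsum_eq_single i₀ fun i hi => Set.indicator_of_notMem (fun h => ?_) _]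
      · rw [Set.indicator_of_mem hxA, sqrt_normAbs_inv_of_mem_shell hi₀]
      · have hQS : Q x ∈ S i := h.2
        have hne : m + (i : ℤ) ≠ m + (i₀ : ℤ) := fun e => hi (by omega)
        exact Set.disjoint_left.1 (disjoint_shell hne) hQS hi₀
  have hseries : ∫⁻ x in B, (((NNReal.sqrt (normAbs F (Q x)))⁻¹ : ℝ≥0) : ℝ≥0∞) ∂ν = ∑' i : ℕ, (w i : ℝ≥0∞) * ν (A i) := by
    rw [setLIntegral_congr_fun hBm hpoint, lintegral_tsum fun i => ((measurable_const.indicator (hAm i)).aemeasurable)]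
    refine tsum_congr fun i => ?_
    rw [lintegral_indicator_const (hAm i), Measure.restrict_apply (hAm i), Set.inter_eq_left.2 (hAB i)]
  -- conclusion
  rw [hseries]
  refine lt_of_le_of_lt (ENNReal.tsum_le_of_sum_range_le fun k => ?_) (ENNReal.ofReal_lt_top (r := M * I))
  have hsum : ∑ i ∈ Finset.range k, (w i : ℝ≥0∞) * ν (A i) = ENNReal.ofReal (∑ i ∈ Finset.range k, (w i : ℝ) * ν.real (A i)) := by
    rw [ENNReal.ofReal_sum_of_nonneg fun i _ => mul_nonneg (NNReal.coe_nonneg _) measureReal_nonneg]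
    refine Finset.sum_congr rfl fun i _ => ?_
    rw [ENNReal.ofReal_mul (NNReal.coe_nonneg _), ENNReal.ofReal_coe_nnreal, measureReal_def, ENNReal.ofReal_toReal (hνA i).ne]
  rw [hsum]
  exact ENNReal.ofReal_le_ofReal (hpartial k)

end Box

end Summit.HodgeConjecture.HodgeConjecture.Cruxes.H413.K2E3DiagonalFormInvSqrtIntegrable

end
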